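import Summits.CriticalPhenomena.PercolationContinuityZ3.Theorems.Transplant.FKConnectivityAllQSPGluing
import Literature.Probability.LatticeModels.RandomClusterEdgeWeights
import HarnessLib

/-!
# Connectivity correlation inequalities for `φ_{w,q}`, every `q > 0` — file 11a: POINTWISE series / parallel composition of the
# two-terminal random-cluster integrands

Support file (`--supports stmt-CriticalPhenomena-4575`), FK sub-lane `prim-bschramm-fk-2` (gen 7) of the post-continuity
programme; builds on p205010 (kernel theorem, internal audit signed; external expert review pending).  No definitions, no named
facts, no sorries; standard axioms.

For a configuration `ω`, two edge sets `E₁, E₂` glued in series (parts on `V₁, V₂`, `V₁ ∩ V₂ ⊆ {m}`, far terminals `a ∉ V₂`,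
`b ∉ V₁`) or in parallel (`V₁ ∩ V₂ ⊆ {s, t}`), `ηᵢ = ω ∩ Eᵢ`, `η = ω ∩ (E₁ ∪ E₂)`, `k = clusterCount · ∅`, and a MARK event
`M` read on the first part (`η ∈ M ↔ η₁ ∈ M`), the integrand `q^{k(η)}·1_{A ∩ M}(η)` of the two-terminal masses is rewritten
as a sum of products of integrands of the parts (`FK.pointwise_series_conn/disc`, `FK.pointwise_parallel_conn/disc`), using the
gluing identities of `…AllQSPGluing.lean` (`k(η) + |V| = k(η₁) + k(η₂) [+ 1{s ↔ t in both}]`, terminal connectivity).  Summing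
these against the product weight gives the composition laws of `…AllQSPLaw.lean` (Grimmett 2006, Thm. (3.90)–(3.91) in
partition-function form; the inductive step of Wagner 2008, Thm. 5.8, for graphs).
[cite: Grimmett2006, §1.4 eq. (1.20) (p. 15); §3.8 Thm. (3.90) (pp. 61–62)] [cite: Wagner2006, Thm. 5.8(d), §5.3]
-/

noncomputable section

namespace Summit.CriticalPhenomena.PercolationContinuityZ3.Theorems

namespace FK

open SimpleGraph Literature.Probability.LatticeModels Literature.Probability.Percolation
open Literature.Probability.Percolation.DecisionTree (ind ind_of_mem ind_of_not_mem ind_nonneg)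
open scoped Classical

variable {V : Type*} [Fintype V]

/-! ### Pointwise composition of the integrands -/

section Pointwise

variable {E₁ E₂ : Set (Sym2 V)} {V₁ V₂ : Set V} {M : Set (BondConfig V)}

omit [Fintype V] in
/-- `1_{A ∩ M}` factorises when membership does. [folklore] -/
theorem ind_eq_mul_of_iff {α : Type*} {A B C : Set α} {x y z : α} (h : x ∈ A ↔ (y ∈ B ∧ z ∈ C)) :
    ind A x = ind B y * ind C z := by
  by_cases hB : y ∈ B
  · by_cases hC : z ∈ C
    · rw [ind_of_mem (h.2 ⟨hB, hC⟩), ind_of_mem hB, ind_of_mem hC, mul_one]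
    · rw [ind_of_not_mem (fun hx => hC (h.1 hx).2), ind_of_mem hB, ind_of_not_mem hC, mul_zero]
  · rw [ind_of_not_mem (fun hx => hB (h.1 hx).1), ind_of_not_mem hB, zero_mul]

/-- **Series, pointwise, connected**: `q^{|V|} q^{k(η)} 1{a↔b, M}(η) = (q^{k(η₁)} 1{a↔m, M}(η₁))(q^{k(η₂)} 1{m↔b}(η₂))`.
[cite: Grimmett2006, §3.8 Thm. (3.90) (p. 61)] -/
theorem pointwise_series_conn (q : ℝ) (h₁ : ∀ e ∈ E₁, ∀ z ∈ e, z ∈ V₁) (h₂ : ∀ e ∈ E₂, ∀ z ∈ e, z ∈ V₂) {a m b : V}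
    (hS : V₁ ∩ V₂ ⊆ {m}) (haV₂ : a ∉ V₂) (hbV₁ : b ∉ V₁) (ham : a ≠ m) (hbm : b ≠ m) (hab : a ≠ b)
    (hM : ∀ η₁ η₂ : Set (Sym2 V), η₁ ⊆ E₁ → η₂ ⊆ E₂ → (η₁ ∪ η₂ ∈ M ↔ η₁ ∈ M)) (ω : BondConfig V) :
    q ^ Fintype.card V * (q ^ clusterCount (ω ∩ (E₁ ∪ E₂)) ∅ * ind (openConn a b ∩ M) (ω ∩ (E₁ ∪ E₂))) =
      (q ^ clusterCount (ω ∩ E₁) ∅ * ind (openConn a m ∩ M) (ω ∩ E₁)) *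
        (q ^ clusterCount (ω ∩ E₂) ∅ * ind (openConn m b) (ω ∩ E₂)) := by
  rw [Set.inter_union_distrib_left]
  have hk := clusterCount_series h₁ h₂ hS (Set.inter_subset_right : ω ∩ E₁ ⊆ E₁) (Set.inter_subset_right : ω ∩ E₂ ⊆ E₂)
  have hr := reachable_series_iff h₁ h₂ hS (Set.inter_subset_right : ω ∩ E₁ ⊆ E₁) (Set.inter_subset_right : ω ∩ E₂ ⊆ E₂)
    haV₂ hbV₁ ham hbm hab
  have hi : ind (openConn a b ∩ M) (ω ∩ E₁ ∪ ω ∩ E₂) = ind (openConn a m ∩ M) (ω ∩ E₁) * ind (openConn m b) (ω ∩ E₂) := by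
    refine ind_eq_mul_of_iff ⟨fun h => ?_, fun h => ?_⟩
    · have hc := hr.1 h.1
      exact ⟨⟨hc.1, (hM _ _ Set.inter_subset_right Set.inter_subset_right).1 h.2⟩, hc.2⟩
    · exact ⟨hr.2 ⟨h.1.1, h.2⟩, (hM _ _ Set.inter_subset_right Set.inter_subset_right).2 h.1.2⟩
  have hq : q ^ Fintype.card V * q ^ clusterCount (ω ∩ E₁ ∪ ω ∩ E₂) ∅ =
      q ^ clusterCount (ω ∩ E₁) ∅ * q ^ clusterCount (ω ∩ E₂) ∅ := by
    rw [← pow_add, ← pow_add, add_comm, hk]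
  rw [hi, ← mul_assoc, hq]; ring

/-- **Series, pointwise, disconnected**:
`q^{|V|} q^{k(η)} 1{a↮b, M}(η) = (q^{k₁}1{a↔m,M}(η₁))(q^{k₂}1{m↮b}(η₂)) + (q^{k₁}1{a↮m,M}(η₁))(q^{k₂}(η₂))`.
[cite: Grimmett2006, §3.8 Thm. (3.90) (p. 61)] -/
theorem pointwise_series_disc (q : ℝ) (h₁ : ∀ e ∈ E₁, ∀ z ∈ e, z ∈ V₁) (h₂ : ∀ e ∈ E₂, ∀ z ∈ e, z ∈ V₂) {a m b : V}
    (hS : V₁ ∩ V₂ ⊆ {m}) (haV₂ : a ∉ V₂) (hbV₁ : b ∉ V₁) (ham : a ≠ m) (hbm : b ≠ m) (hab : a ≠ b)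
    (hM : ∀ η₁ η₂ : Set (Sym2 V), η₁ ⊆ E₁ → η₂ ⊆ E₂ → (η₁ ∪ η₂ ∈ M ↔ η₁ ∈ M)) (ω : BondConfig V) :
    q ^ Fintype.card V * (q ^ clusterCount (ω ∩ (E₁ ∪ E₂)) ∅ * ind ((openConn a b)ᶜ ∩ M) (ω ∩ (E₁ ∪ E₂))) =
      (q ^ clusterCount (ω ∩ E₁) ∅ * ind (openConn a m ∩ M) (ω ∩ E₁)) *
          (q ^ clusterCount (ω ∩ E₂) ∅ * ind (openConn m b)ᶜ (ω ∩ E₂)) +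
        (q ^ clusterCount (ω ∩ E₁) ∅ * ind ((openConn a m)ᶜ ∩ M) (ω ∩ E₁)) *
          (q ^ clusterCount (ω ∩ E₂) ∅ * ind Set.univ (ω ∩ E₂)) := by
  rw [Set.inter_union_distrib_left]
  have hk := clusterCount_series h₁ h₂ hS (Set.inter_subset_right : ω ∩ E₁ ⊆ E₁) (Set.inter_subset_right : ω ∩ E₂ ⊆ E₂)
  have hr := reachable_series_iff h₁ h₂ hS (Set.inter_subset_right : ω ∩ E₁ ⊆ E₁) (Set.inter_subset_right : ω ∩ E₂ ⊆ E₂)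
    haV₂ hbV₁ ham hbm hab
  have hM' := hM _ _ (Set.inter_subset_right : ω ∩ E₁ ⊆ E₁) (Set.inter_subset_right : ω ∩ E₂ ⊆ E₂)
  have hq : q ^ Fintype.card V * q ^ clusterCount (ω ∩ E₁ ∪ ω ∩ E₂) ∅ =
      q ^ clusterCount (ω ∩ E₁) ∅ * q ^ clusterCount (ω ∩ E₂) ∅ := by
    rw [← pow_add, ← pow_add, add_comm, hk]
  have hi : ind ((openConn a b)ᶜ ∩ M) (ω ∩ E₁ ∪ ω ∩ E₂) =
      ind (openConn a m ∩ M) (ω ∩ E₁) * ind (openConn m b)ᶜ (ω ∩ E₂) +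
        ind ((openConn a m)ᶜ ∩ M) (ω ∩ E₁) * ind Set.univ (ω ∩ E₂) := by
    rw [ind_of_mem (Set.mem_univ _), mul_one]
    by_cases hMm : ω ∩ E₁ ∈ M
    · by_cases h1 : ω ∩ E₁ ∈ openConn a m
      · have hn : ω ∩ E₁ ∉ (openConn a m)ᶜ ∩ M := fun h => h.1 h1
        rw [ind_of_mem (Set.mem_inter h1 hMm), ind_of_not_mem hn, one_mul, add_zero]
        by_cases h2 : ω ∩ E₂ ∈ openConn m b
        · have hn2 : ω ∩ E₂ ∉ (openConn m b)ᶜ := fun h => h h2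
          have hn' : ω ∩ E₁ ∪ ω ∩ E₂ ∉ (openConn a b)ᶜ ∩ M := fun h => h.1 (hr.2 ⟨h1, h2⟩)
          rw [ind_of_not_mem hn', ind_of_not_mem hn2]
        · have hy' : ω ∩ E₁ ∪ ω ∩ E₂ ∈ (openConn a b)ᶜ ∩ M := ⟨fun h => h2 (hr.1 h).2, hM'.2 hMm⟩
          rw [ind_of_mem hy', ind_of_mem (show ω ∩ E₂ ∈ (openConn m b)ᶜ from h2)]
      · have hy : ω ∩ E₁ ∈ (openConn a m)ᶜ ∩ M := ⟨h1, hMm⟩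
        have hn : ω ∩ E₁ ∉ openConn a m ∩ M := fun h => h1 h.1
        have hy' : ω ∩ E₁ ∪ ω ∩ E₂ ∈ (openConn a b)ᶜ ∩ M := ⟨fun h => h1 (hr.1 h).1, hM'.2 hMm⟩
        rw [ind_of_mem hy', ind_of_mem hy, ind_of_not_mem hn, zero_mul, zero_add]
    · have hn1 : ω ∩ E₁ ∉ openConn a m ∩ M := fun h => hMm h.2
      have hn2 : ω ∩ E₁ ∉ (openConn a m)ᶜ ∩ M := fun h => hMm h.2
      have hn' : ω ∩ E₁ ∪ ω ∩ E₂ ∉ (openConn a b)ᶜ ∩ M := fun h => hMm (hM'.1 h.2)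
      rw [ind_of_not_mem hn', ind_of_not_mem hn1, ind_of_not_mem hn2]; ring
  calc q ^ Fintype.card V * (q ^ clusterCount (ω ∩ E₁ ∪ ω ∩ E₂) ∅ * ind ((openConn a b)ᶜ ∩ M) (ω ∩ E₁ ∪ ω ∩ E₂))
      = (q ^ Fintype.card V * q ^ clusterCount (ω ∩ E₁ ∪ ω ∩ E₂) ∅) * ind ((openConn a b)ᶜ ∩ M) (ω ∩ E₁ ∪ ω ∩ E₂) := by ring
    _ = _ := by rw [hq, hi]; ring

/-- **Parallel, pointwise, connected**: `q^{|V|} q^{k(η)} 1{s↔t, M}(η) =`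
`(q^{k₁}1{s↔t,M}(η₁))(q^{k₂}1{s↮t}(η₂)) + (q^{k₁}1{s↮t,M}(η₁))(q^{k₂}1{s↔t}(η₂)) + q (q^{k₁}1{s↔t,M}(η₁))(q^{k₂}1{s↔t}(η₂))`.
[cite: Grimmett2006, §3.8 Thm. (3.91) (p. 62)] -/
theorem pointwise_parallel_conn (q : ℝ) (h₁ : ∀ e ∈ E₁, ∀ z ∈ e, z ∈ V₁) (h₂ : ∀ e ∈ E₂, ∀ z ∈ e, z ∈ V₂) {s t : V}
    (hS : V₁ ∩ V₂ ⊆ {s, t}) (hst : s ≠ t)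
    (hM : ∀ η₁ η₂ : Set (Sym2 V), η₁ ⊆ E₁ → η₂ ⊆ E₂ → (η₁ ∪ η₂ ∈ M ↔ η₁ ∈ M)) (ω : BondConfig V) :
    q ^ Fintype.card V * (q ^ clusterCount (ω ∩ (E₁ ∪ E₂)) ∅ * ind (openConn s t ∩ M) (ω ∩ (E₁ ∪ E₂))) =
      (q ^ clusterCount (ω ∩ E₁) ∅ * ind (openConn s t ∩ M) (ω ∩ E₁)) *
          (q ^ clusterCount (ω ∩ E₂) ∅ * ind (openConn s t)ᶜ (ω ∩ E₂)) +
        (q ^ clusterCount (ω ∩ E₁) ∅ * ind ((openConn s t)ᶜ ∩ M) (ω ∩ E₁)) *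
          (q ^ clusterCount (ω ∩ E₂) ∅ * ind (openConn s t) (ω ∩ E₂)) +
        q * ((q ^ clusterCount (ω ∩ E₁) ∅ * ind (openConn s t ∩ M) (ω ∩ E₁)) *
          (q ^ clusterCount (ω ∩ E₂) ∅ * ind (openConn s t) (ω ∩ E₂))) := by
  rw [Set.inter_union_distrib_left]
  have hk := clusterCount_parallel h₁ h₂ hS (Set.inter_subset_right : ω ∩ E₁ ⊆ E₁) (Set.inter_subset_right : ω ∩ E₂ ⊆ E₂)
    hst
  have hr := reachable_parallel_iff h₁ h₂ hS (Set.inter_subset_right : ω ∩ E₁ ⊆ E₁) (Set.inter_subset_right : ω ∩ E₂ ⊆ E₂)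
  have hM' := hM _ _ (Set.inter_subset_right : ω ∩ E₁ ⊆ E₁) (Set.inter_subset_right : ω ∩ E₂ ⊆ E₂)
  set k₁ := clusterCount (ω ∩ E₁) ∅ with hk₁
  set k₂ := clusterCount (ω ∩ E₂) ∅ with hk₂
  set k := clusterCount (ω ∩ E₁ ∪ ω ∩ E₂) ∅ with hk₀
  by_cases hMm : ω ∩ E₁ ∈ M
  · by_cases r1 : ω ∩ E₁ ∈ openConn s t
    · have i1 : ind (openConn s t ∩ M) (ω ∩ E₁) = 1 := ind_of_mem ⟨r1, hMm⟩
      have i1' : ind ((openConn s t)ᶜ ∩ M) (ω ∩ E₁) = 0 := ind_of_not_mem fun h => h.1 r1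
      have iu : ind (openConn s t ∩ M) (ω ∩ E₁ ∪ ω ∩ E₂) = 1 := ind_of_mem ⟨hr.2 (Or.inl r1), hM'.2 hMm⟩
      by_cases r2 : ω ∩ E₂ ∈ openConn s t
      · have i2 : ind (openConn s t) (ω ∩ E₂) = 1 := ind_of_mem r2
        have i2' : ind (openConn s t)ᶜ (ω ∩ E₂) = 0 := ind_of_not_mem fun h => h r2
        have hr12 : (openGraph (ω ∩ E₁)).Reachable s t ∧ (openGraph (ω ∩ E₂)).Reachable s t := ⟨r1, r2⟩
        rw [if_pos hr12] at hk
        rw [i1, i1', iu, i2, i2']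
        have hq : q ^ Fintype.card V * q ^ k = q * (q ^ k₁ * q ^ k₂) := by
          rw [← pow_add, ← pow_add, add_comm, hk, pow_succ]; ring
        calc q ^ Fintype.card V * (q ^ k * 1) = q ^ Fintype.card V * q ^ k := by ring
          _ = _ := by rw [hq]; ring
      · have i2 : ind (openConn s t) (ω ∩ E₂) = 0 := ind_of_not_mem r2
        have i2' : ind (openConn s t)ᶜ (ω ∩ E₂) = 1 := ind_of_mem (show ω ∩ E₂ ∈ (openConn s t)ᶜ from r2)
        have hr12 : ¬ ((openGraph (ω ∩ E₁)).Reachable s t ∧ (openGraph (ω ∩ E₂)).Reachable s t) := fun h => r2 h.2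
        rw [if_neg hr12, add_zero] at hk
        rw [i1, i1', iu, i2, i2']
        have hq : q ^ Fintype.card V * q ^ k = q ^ k₁ * q ^ k₂ := by
          rw [← pow_add, ← pow_add, add_comm, hk]
        calc q ^ Fintype.card V * (q ^ k * 1) = q ^ Fintype.card V * q ^ k := by ring
          _ = _ := by rw [hq]; ring
    · have i1 : ind (openConn s t ∩ M) (ω ∩ E₁) = 0 := ind_of_not_mem fun h => r1 h.1
      have i1' : ind ((openConn s t)ᶜ ∩ M) (ω ∩ E₁) = 1 := ind_of_mem ⟨r1, hMm⟩
      have hr12 : ¬ ((openGraph (ω ∩ E₁)).Reachable s t ∧ (openGraph (ω ∩ E₂)).Reachable s t) := fun h => r1 h.1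
      rw [if_neg hr12, add_zero] at hk
      have hq : q ^ Fintype.card V * q ^ k = q ^ k₁ * q ^ k₂ := by
        rw [← pow_add, ← pow_add, add_comm, hk]
      by_cases r2 : ω ∩ E₂ ∈ openConn s t
      · have i2 : ind (openConn s t) (ω ∩ E₂) = 1 := ind_of_mem r2
        have iu : ind (openConn s t ∩ M) (ω ∩ E₁ ∪ ω ∩ E₂) = 1 := ind_of_mem ⟨hr.2 (Or.inr r2), hM'.2 hMm⟩
        rw [i1, i1', iu, i2]
        calc q ^ Fintype.card V * (q ^ k * 1) = q ^ Fintype.card V * q ^ k := by ring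
          _ = _ := by rw [hq]; ring
      · have i2 : ind (openConn s t) (ω ∩ E₂) = 0 := ind_of_not_mem r2
        have iu : ind (openConn s t ∩ M) (ω ∩ E₁ ∪ ω ∩ E₂) = 0 :=
          ind_of_not_mem fun h => (hr.1 h.1).elim r1 r2
        rw [i1, i1', iu, i2]; ring
  · have i1 : ind (openConn s t ∩ M) (ω ∩ E₁) = 0 := ind_of_not_mem fun h => hMm h.2
    have i1' : ind ((openConn s t)ᶜ ∩ M) (ω ∩ E₁) = 0 := ind_of_not_mem fun h => hMm h.2
    have iu : ind (openConn s t ∩ M) (ω ∩ E₁ ∪ ω ∩ E₂) = 0 := ind_of_not_mem fun h => hMm (hM'.1 h.2)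
    rw [i1, i1', iu]; ring

/-- **Parallel, pointwise, disconnected**: `q^{|V|} q^{k(η)} 1{s↮t, M}(η) = (q^{k₁}1{s↮t,M}(η₁))(q^{k₂}1{s↮t}(η₂))`.
[cite: Grimmett2006, §3.8 Thm. (3.91) (p. 62)] -/
theorem pointwise_parallel_disc (q : ℝ) (h₁ : ∀ e ∈ E₁, ∀ z ∈ e, z ∈ V₁) (h₂ : ∀ e ∈ E₂, ∀ z ∈ e, z ∈ V₂) {s t : V}
    (hS : V₁ ∩ V₂ ⊆ {s, t}) (hst : s ≠ t)
    (hM : ∀ η₁ η₂ : Set (Sym2 V), η₁ ⊆ E₁ → η₂ ⊆ E₂ → (η₁ ∪ η₂ ∈ M ↔ η₁ ∈ M)) (ω : BondConfig V) :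
    q ^ Fintype.card V * (q ^ clusterCount (ω ∩ (E₁ ∪ E₂)) ∅ * ind ((openConn s t)ᶜ ∩ M) (ω ∩ (E₁ ∪ E₂))) =
      (q ^ clusterCount (ω ∩ E₁) ∅ * ind ((openConn s t)ᶜ ∩ M) (ω ∩ E₁)) *
        (q ^ clusterCount (ω ∩ E₂) ∅ * ind (openConn s t)ᶜ (ω ∩ E₂)) := by
  rw [Set.inter_union_distrib_left]
  have hk := clusterCount_parallel h₁ h₂ hS (Set.inter_subset_right : ω ∩ E₁ ⊆ E₁) (Set.inter_subset_right : ω ∩ E₂ ⊆ E₂)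
    hst
  have hr := reachable_parallel_iff h₁ h₂ hS (Set.inter_subset_right : ω ∩ E₁ ⊆ E₁) (Set.inter_subset_right : ω ∩ E₂ ⊆ E₂)
  have hM' := hM _ _ (Set.inter_subset_right : ω ∩ E₁ ⊆ E₁) (Set.inter_subset_right : ω ∩ E₂ ⊆ E₂)
  by_cases hc : ω ∩ E₁ ∪ ω ∩ E₂ ∈ (openConn s t)ᶜ ∩ M
  · -- neither part joins `s` to `t`
    have r1 : ¬ (openGraph (ω ∩ E₁)).Reachable s t := fun h => hc.1 (hr.2 (Or.inl h))
    have r2 : ¬ (openGraph (ω ∩ E₂)).Reachable s t := fun h => hc.1 (hr.2 (Or.inr h))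
    have hr12 : ¬ ((openGraph (ω ∩ E₁)).Reachable s t ∧ (openGraph (ω ∩ E₂)).Reachable s t) := fun h => r1 h.1
    rw [if_neg hr12, add_zero] at hk
    rw [ind_of_mem hc, ind_of_mem (show ω ∩ E₁ ∈ (openConn s t)ᶜ ∩ M from ⟨r1, hM'.1 hc.2⟩),
      ind_of_mem (show ω ∩ E₂ ∈ (openConn s t)ᶜ from r2)]
    have hq : q ^ Fintype.card V * q ^ clusterCount (ω ∩ E₁ ∪ ω ∩ E₂) ∅ =
        q ^ clusterCount (ω ∩ E₁) ∅ * q ^ clusterCount (ω ∩ E₂) ∅ := by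
      rw [← pow_add, ← pow_add, add_comm, hk]
    calc q ^ Fintype.card V * (q ^ clusterCount (ω ∩ E₁ ∪ ω ∩ E₂) ∅ * 1)
        = q ^ Fintype.card V * q ^ clusterCount (ω ∩ E₁ ∪ ω ∩ E₂) ∅ := by ring
      _ = _ := by rw [hq]; ring
  · rw [ind_of_not_mem hc, mul_zero, mul_zero]
    -- one of the two factors on the right vanishes
    by_cases hMm : ω ∩ E₁ ∈ M
    · have h' : (openGraph (ω ∩ E₁)).Reachable s t ∨ (openGraph (ω ∩ E₂)).Reachable s t := by
        by_contra hn
        exact hc ⟨fun h => hn (hr.1 h), hM'.2 hMm⟩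
      rcases h' with h | h
      · rw [ind_of_not_mem (show ω ∩ E₁ ∉ (openConn s t)ᶜ ∩ M from fun h' => h'.1 h)]; ring
      · rw [ind_of_not_mem (show ω ∩ E₂ ∉ (openConn s t)ᶜ from fun h' => h' h)]; ring
    · rw [ind_of_not_mem (show ω ∩ E₁ ∉ (openConn s t)ᶜ ∩ M from fun h' => hMm h'.2)]; ring

end Pointwise

end FK

end Summit.CriticalPhenomena.PercolationContinuityZ3.Theorems

end
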